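import Summits.ResolutionOfSingularities.ResolutionOfSingularities.Theorems.FrobeniusLadderFRationalResolutionClassOneThirdOneTwo
import Summits.ResolutionOfSingularities.ResolutionOfSingularities.Theorems.FrobeniusLadderFRationalResolutionConeHomOfMatrix
import HarnessLib

/-!
# Crux `FrobeniusLadder.FRationalResolution` (stmt-ResolutionOfSingularities-15317), line `redirect`,
# stub `stub_diagonalizableQuotientResolution` — FREE VERTEX CHARTS IN ANY DIMENSION from an injective integer matrix
# (the `n × n` form of `…ClassOneFourthOneThree.freeChart_of_matrix`; item (β-cert-3) of MEMO-15317-leafhand2-g26 §4)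

For the threefold classes the free vertex charts are `Q = ℕ³` with a `3 × 3` integer matrix. This file states the free-chart step for
ANY `n, n'`: the matrix map `L : ℕ^{n'} → ℤⁿ` (`…ConeHomOfMatrix.exists_matrixHom`), its injectivity from an integer LEFT INVERSE up to
a denominator (`L' (L eᵢ) = N eᵢ`, a finite check), and the per-vertex slot of
`…ConeCertificateFreeChart.hasResolution_of_isolated_fixedPoints_of_mixedConeCertificate` (first disjunct) from three generator checks
phrased with `L` on plain exponents `u : ℕ^{n'}` (no subtype of `⊤`).

* `matrixHom_injective_of_leftInverse` — injectivity of `L` on `ℕ^{n'}`;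
* ★★★ `freeChart_of_matrixHom` — the free vertex chart from `L` and generator checks, any dimension.

Honest label: combinatorial helper toward ONE leaf stub (no stub, crux or summit closed). No definitions, no named facts, no sorry.
[folklore; cite: CoxLittleSchenck2011, §1.2]
-/

noncomputable section

-- single-problem summit: the doubled namespace component is forced
set_option linter.dupNamespace false

open AlgebraicGeometry
open Literature.AlgebraicGeometry.Resolution

namespace Summit.ResolutionOfSingularities.ResolutionOfSingularities.Theorems.FRationalResolution.ConeCertificateGenerators

/-- The exponent of `p ∈ ℕⁿ` in `ℤⁿ`. -/
local notation3 (prettyPrint := false) "toZ[" n "]" =>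
  (Finsupp.mapRange.addMonoidHom (Nat.castAddMonoidHom ℤ) : (Fin n →₀ ℕ) →+ (Fin n →₀ ℤ))

variable {n n' : ℕ}

/-- **Injectivity of an additive `L : ℕ^{n'} → N` from a left inverse up to a denominator**: if an additive `L' : N → ℤ^{n'}` has
`L' (L eᵢ) = N • eᵢ` for every standard generator `eᵢ` and `N ≠ 0`, then `L` is injective. [folklore] -/
theorem matrixHom_injective_of_leftInverse {M : Type} [AddCommGroup M] (L : (Fin n' →₀ ℕ) →+ M) (L' : M →+ (Fin n' →₀ ℤ))
    (N : ℤ) (hN : N ≠ 0) (hinv : ∀ i : Fin n', L' (L (Finsupp.single i 1)) = Finsupp.single i N) :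
    Function.Injective L := by
  -- `L' ∘ L = N • toZ` on generators, hence everywhere
  have hcomp : L'.comp L = (N • (Finsupp.mapRange.addMonoidHom (Nat.castAddMonoidHom ℤ) : (Fin n' →₀ ℕ) →+ (Fin n' →₀ ℤ))) := by
    refine AddMonoidHom.eq_of_eqOn_denseM (ClassOneThirdOneTwo.closure_range_single_one_eq_top n') ?_
    rintro _ ⟨i, rfl⟩
    rw [AddMonoidHom.comp_apply, hinv, AddMonoidHom.smul_apply]
    ext j
    simp [Finsupp.single_apply]
  intro u w h
  have h' : N • toZ[n'] u = N • toZ[n'] w := by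
    have := congrArg L' h
    rw [← AddMonoidHom.comp_apply, ← AddMonoidHom.comp_apply, hcomp] at this
    exact this
  ext i
  have hi := DFunLike.congr_fun h' i
  simp only [Finsupp.coe_smul, Pi.smul_apply, smul_eq_mul] at hi
  have hi' := mul_left_cancel₀ hN hi
  simpa using hi'

/-- ★★★ **A FREE VERTEX CHART FROM AN INJECTIVE INTEGER MATRIX, ANY DIMENSION.** `P = ⟨G⟩ ⊆ ℕⁿ`, `v ∈ P`, an injective additive
`L : ℕ^{n'} → ℤⁿ` (e.g. from `exists_matrixHom` + `matrixHom_injective_of_leftInverse`) with the generator checks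
(hPQ) every `g ∈ G` is an `L u`, (hE) every `g − v` is an `L u`, (hQ) every `L eᵢ` is `p + Σ (eⱼ − v)`: then the per-vertex slot holds
with `Q = ⊤ = ℕ^{n'}` and the first disjunct (`κ[ℕ^{n'}]` regular over every field). [folklore; cite: CoxLittleSchenck2011, §1.2] -/
theorem freeChart_of_matrixHom (P : AddSubmonoid (Fin n →₀ ℕ)) (G : Set (Fin n →₀ ℕ)) (hGP : AddSubmonoid.closure G = P) (v : ↥P)
    (L : (Fin n' →₀ ℕ) →+ (Fin n →₀ ℤ)) (hL : Function.Injective L)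
    (hG1 : ∀ g ∈ G, ∃ u : Fin n' →₀ ℕ, L u = toZ[n] g)
    (hG2 : ∀ g ∈ G, ∃ u : Fin n' →₀ ℕ, L u = toZ[n] g - toZ[n] (v : Fin n →₀ ℕ))
    (hG3 : ∀ i : Fin n', ∃ (p : ↥P) (r : ℕ) (e : Fin r → ↥P), (∀ l, e l ≠ 0) ∧
      L (Finsupp.single i 1) = toZ[n] (p : Fin n →₀ ℕ) + ∑ l, (toZ[n] ((e l : ↥P) : Fin n →₀ ℕ) - toZ[n] (v : Fin n →₀ ℕ))) :
    ∃ (n'' : ℕ) (Q : AddSubmonoid (Fin n'' →₀ ℕ)) (ι : ↥Q →+ (Fin n →₀ ℤ)) (_ : Function.Injective ι)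
      (_ : ∀ e : ↥P, e ≠ 0 → ∃ u : ↥Q, ι u = toZ[n] (e : Fin n →₀ ℕ) - toZ[n] (v : Fin n →₀ ℕ))
      (_ : ∀ p : ↥P, ∃ u : ↥Q, ι u = toZ[n] (p : Fin n →₀ ℕ))
      (_ : ∀ u : ↥Q, ∃ (p : ↥P) (r : ℕ) (e : Fin r → ↥P), (∀ i, e i ≠ 0) ∧
        ι u = toZ[n] (p : Fin n →₀ ℕ) + ∑ i, (toZ[n] ((e i : ↥P) : Fin n →₀ ℕ) - toZ[n] (v : Fin n →₀ ℕ))),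
      (∀ (κ : Type) [Field κ], IsRegularRing (AddMonoidAlgebra κ ↥Q)) ∨
      ∃ (GQ : Set (Fin n'' →₀ ℕ)) (_ : GQ.Finite) (_ : (0 : Fin n'' →₀ ℕ) ∉ GQ) (_ : AddSubmonoid.closure GQ = Q),
        (∀ (κ : Type) [Field κ], ∀ u : ↥Q, (u : Fin n'' →₀ ℕ) ∈ GQ →
          IsRegularRing (Localization.Away (AddMonoidAlgebra.single u (1 : κ)))) ∧
        (∀ (K : Type) [Field K], Scheme.IsRegular (affineBlowup (Ideal.span {w : ↥(Algebra.adjoin K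
          ((fun d : Fin n'' →₀ ℕ => MvPolynomial.monomial d (1 : K)) '' GQ)) |
          ∃ d ∈ GQ, (w : MvPolynomial (Fin n'') K) = MvPolynomial.monomial d 1}))) := by
  let ι : ↥(⊤ : AddSubmonoid (Fin n' →₀ ℕ)) →+ (Fin n →₀ ℤ) := L.comp (AddSubmonoid.subtype ⊤)
  have hι : ∀ u, ι u = L (u : Fin n' →₀ ℕ) := fun _ => rfl
  have hιinj : Function.Injective ι := fun u w h => Subtype.ext (hL (by rwa [hι, hι] at h))
  have mem : ∀ w : Fin n' →₀ ℕ, w ∈ (⊤ : AddSubmonoid (Fin n' →₀ ℕ)) := fun w => AddSubmonoid.mem_top w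
  have hG1' : ∀ g ∈ G, ∃ u : ↥(⊤ : AddSubmonoid (Fin n' →₀ ℕ)), ι u = toZ[n] g := fun g hg => by
    obtain ⟨u, hu⟩ := hG1 g hg; exact ⟨⟨u, mem u⟩, hu⟩
  have hG2' : ∀ g ∈ G, ∃ u : ↥(⊤ : AddSubmonoid (Fin n' →₀ ℕ)), ι u = toZ[n] g - toZ[n] (v : Fin n →₀ ℕ) := fun g hg => by
    obtain ⟨u, hu⟩ := hG2 g hg; exact ⟨⟨u, mem u⟩, hu⟩
  have hG3' : ∀ u : ↥(⊤ : AddSubmonoid (Fin n' →₀ ℕ)), (u : Fin n' →₀ ℕ) ∈ Set.range (fun i : Fin n' => (Finsupp.single i 1 : Fin n' →₀ ℕ)) →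
      ∃ (p : ↥P) (r : ℕ) (e : Fin r → ↥P), (∀ l, e l ≠ 0) ∧
        ι u = toZ[n] (p : Fin n →₀ ℕ) + ∑ l, (toZ[n] ((e l : ↥P) : Fin n →₀ ℕ) - toZ[n] (v : Fin n →₀ ℕ)) := by
    rintro u ⟨i, hi⟩
    obtain ⟨p, r, e, he, h⟩ := hG3 i
    exact ⟨p, r, e, he, by rw [hι, ← hi, h]⟩
  have hPQ := forall_exists_eq_of_generators P ⊤ ι (toZ[n]) G hGP hG1'
  exact ⟨n', ⊤, ι, hιinj, forall_exists_eq_sub_of_generators P ⊤ ι (toZ[n]) G hGP _ hG2' hPQ, hPQ,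
    forall_exists_decomp_of_generators P ⊤ ι (toZ[n]) _ _ (ClassOneThirdOneTwo.closure_range_single_one_eq_top n') hG3',
    Or.inl fun κ _ => MonoidAlgebraLaurent.isRegularRing_monoidAlgebra_top κ n'⟩

end Summit.ResolutionOfSingularities.ResolutionOfSingularities.Theorems.FRationalResolution.ConeCertificateGenerators

end
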